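import Literature.NumberTheory.DiophantineGeometry.PlaneCurvePointCountFinalProofs
import Literature.NumberTheory.DiophantineGeometry.BertiniHomogenizationProofs
import Mathlib.FieldTheory.IsAlgClosed.Basic
import Literature.NumberTheory.DiophantineGeometry.BertiniBadPlaneCountProofs
import HarnessLib

/-!
# Cafure–Matera (2006), Theorem 5.2: averaging over parametrised planes, assembly, and `δ ≤ 5`

Let `K = 𝔽_q`, `f ∈ K[X₁, …, Xₙ]` of degree `δ`, `N = #{x ∈ Kⁿ : f(x) = 0}`. For a *parametrised
plane* `φ = (p, v, w) ∈ (Kⁿ)³` let `f_φ(X, Y) = f(p + Xv + Yw) ∈ K[X][Y]` be the plane section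
(`MvPolynomial.aeval` at `θᵢ = wᵢ Y + (pᵢ + vᵢ X)`, as in `PlaneSectionBookkeepingProofs`),
`N_φ = #{(s, t) ∈ K² : f_φ(s, t) = 0}`, and `m(φ)` the number of distinct irreducible factors of
`f_φ` over `K`. This file carries out the proof of Cafure–Matera's Theorem 5.2
(`|N - q^{n-1}| ≤ (δ-1)(δ-2) q^{n-3/2} + 5 δ^{13/3} q^{n-2}` for `f` absolutely irreducible) up to the
effective Bertini input, in a parametrised form that avoids counting `𝔽_q`-planes:

1. **Averaging** ((16)–(21) of the paper): `evalEval_planeSection` (`f_φ(s, t) = f(p + sv + tw)`);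
   `sum_card_planeSection` (`∑_φ N_φ = q^{2n+2} N`), whence `q^{2n+2} |N - q^{n-1}| ≤ ∑_φ |N_φ - q|`;
   `card_filter_planeSection_pvw_eq_zero_le` (`f_φ = 0` forces `f(p) = 0` and `f_δ(w) = 0`: at
   most `δ² q^{3n-2}` sections vanish, the `C`-term (18), by Lemma 2.1 twice);
   `card_filter_not_linearIndependent_le` (the `D`-term (19)); and
   `mul_abs_sub_le_of_planeSections`: with the plane-curve estimates **P1**/**P2** of
   `PlaneCurvePointCountFinalProofs` (replacing Lemma 5.1),
   `q^{2n+2} |N - q^{n-1}| ≤ q^{3n} ω + q B + δ² q^{3n} + δ (q+1) q^{2n+1}`, `ω = (δ-1)(δ-2)√q + δ³`,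
   `B = ∑_{φ bad} max(1, m(φ) - 1)` the weighted number of non-degenerate parameters whose section
   is non-zero but not absolutely irreducible.
2. **Assembly**: `CafureMatera2006_thm52_of_bad_le` / `CafureMatera2006_thm52_of_prop41` reduce
   Theorem 5.2 to a bound `B ≤ c_B(δ) q^{3n-1}` with `δ³ + δ² + 1 + c_B(δ) ≤ 5δ^{13/3}` (the
   parametrised Prop. 4.1), using the cases `δ = 1` and `q ≤ 5δ^{10/3}` of `CafureMateraProofs`, the
   cases `n ≤ 2` (for `n = 1` an absolutely irreducible `f` is linear; for `n = 2` **P1** applies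
   directly), and `numeric_thm52`.
3. **Degree `δ ≤ 5`, unconditionally**: `CafureMatera2006_thm52_of_totalDegree_le_five`, bounding
   `B` through the parametrised Cor. 3.2 alone (`BertiniBadPlaneCountProofs`, from Kaltofen's
   certificate): the weights are `≤ δ - 1` and `δ³ + δ² + 1 + (δ-1)(2δ⁴ - δ³ + 2δ² + 1) ≤ 5δ^{13/3}`
   exactly for `δ ≤ 5`.

The general case (Cor. 3.4 and Prop. 4.1 parametrised, `CafureMatera2006_thm52_holds`) is in
`CafureMateraThm52Proofs`. No definitions, no new named facts.

## References

* A. Cafure, G. Matera, *Improved explicit estimates on the number of solutions of equations over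
  a finite field*, Finite Fields Appl. 12 (2006) 155–185, Cor. 3.2, Prop. 4.1, §5.1 (16)–(23),
  Thm. 5.2. [CafureMatera2006]
* E. Kaltofen, *Effective Noether irreducibility forms and applications*, J. Comput. System Sci.
  50 (1995) 274–295, Thm. 5. [Kaltofen1995]
-/

noncomputable section

/-! ## Part 1: averaging over parametrised planes -/

open scoped Classical Polynomial.Bivariate
open Polynomial

namespace Literature.NumberTheory.DiophantineGeometry

universe u

variable {K : Type u} [Field K] {n : ℕ}

/-- The plane section `f(p + Xv + Yw) ∈ K[X][Y]` (local notation for the `MvPolynomial.aeval`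
term, in the shape of `PlaneSectionBookkeepingProofs`). -/
local notation3 (prettyPrint := false) "sec[" f ", " p ", " v ", " w "]" =>
  (MvPolynomial.aeval (R := K) (fun i ↦ Polynomial.C (Polynomial.C (w i)) * Polynomial.X +
      Polynomial.C (Polynomial.C (p i) + Polynomial.C (v i) * Polynomial.X) :
    Fin n → Polynomial (Polynomial K)) f)

/-! ### Evaluating a plane section -/

/-- **`f_φ(s, t) = f(p + sv + tw)`.** [folklore] -/
theorem evalEval_planeSection (f : MvPolynomial (Fin n) K) (p v w : Fin n → K) (s t : K) :
    (sec[f, p, v, w]).evalEval s t = MvPolynomial.eval (fun i ↦ p i + v i * s + w i * t) f := by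
  rw [← coe_aevalAeval_eq_evalEval, MvPolynomial.comp_aeval_apply]
  change _ = MvPolynomial.aeval (R := K) (fun i ↦ p i + v i * s + w i * t) f
  congr 2
  funext i
  simp only [map_add, map_mul, aevalAeval_C, aeval_C, aeval_X, aevalAeval_Y,
    Algebra.algebraMap_self_apply]
  ring

/-- The inner polynomials `pᵢ + vᵢ X` have degree `≤ 1`. [folklore] -/
theorem natDegree_C_add_C_mul_X_le (a b : K) : (C a + C b * X : K[X]).natDegree ≤ 1 := by
  refine (natDegree_add_le _ _).trans (max_le (by simp) ?_)
  exact (natDegree_C_mul_le _ _).trans natDegree_X_le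

/-- **Total degree of a plane section** in the `coeff`-`coeff` form: no monomial `X^j Y^k` with
`j + k > deg f`. [folklore] -/
theorem coeff_coeff_planeSection_eq_zero (f : MvPolynomial (Fin n) K) (p v w : Fin n → K) :
    ∀ k j, f.totalDegree < j + k → ((sec[f, p, v, w]).coeff k).coeff j = 0 :=
  coeff_coeff_aeval_affine_eq_zero f w (fun i ↦ C (p i) + C (v i) * X)
    fun i ↦ natDegree_C_add_C_mul_X_le (p i) (v i)

/-- **A vanishing section forces `f(p) = 0` and `f_δ(w) = 0`.** [folklore] -/
theorem eval_eq_zero_and_of_planeSection_eq_zero {f : MvPolynomial (Fin n) K} {p v w : Fin n → K}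
    (h : sec[f, p, v, w] = 0) :
    MvPolynomial.eval p f = 0 ∧
      MvPolynomial.eval w (MvPolynomial.homogeneousComponent f.totalDegree f) = 0 := by
  constructor
  · have := evalEval_planeSection f p v w 0 0
    rw [h, evalEval_zero] at this
    simpa using this.symm
  · have := coeff_aeval_affine_totalDegree f w (fun i ↦ C (p i) + C (v i) * X)
    rw [h, coeff_zero] at this
    exact C_injective (by rw [← this, map_zero])

variable [Fintype K]

/-! ### The double count `∑_φ N_φ = q^{2n+2} N` -/

/-- Translation invariance of the point count: `#{p : f(p + c) = 0} = #{x : f(x) = 0}`.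
[folklore] -/
theorem card_filter_eval_add_eq (f : MvPolynomial (Fin n) K) (c : Fin n → K) :
    (Finset.univ.filter fun p : Fin n → K ↦ MvPolynomial.eval (p + c) f = 0).card =
      (Finset.univ.filter fun x : Fin n → K ↦ MvPolynomial.eval x f = 0).card := by
  refine Finset.card_bij (fun p _ ↦ p + c) (fun p hp ↦ ?_) (fun p₁ _ p₂ _ h ↦ add_right_cancel h)
    (fun x hx ↦ ⟨x - c, ?_, sub_add_cancel x c⟩)
  · rw [Finset.mem_filter] at hp ⊢
    exact ⟨Finset.mem_univ _, hp.2⟩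
  · rw [Finset.mem_filter] at hx ⊢
    exact ⟨Finset.mem_univ _, by rw [sub_add_cancel]; exact hx.2⟩

/-- **`∑_φ N_φ = q^{2n+2} N`:** summing the numbers of rational zeros of all plane sections
`f(p + sv + tw)`, `(p, v, w) ∈ (Kⁿ)³`, counts every rational zero of `f` exactly `q^{2n}` times
for each `(s, t) ∈ K²`. (The parametrised form of Cafure–Matera's count `E` of the planes through
a point, (20).) [cite: CafureMatera2006, §5.1 (20)–(21)] -/
theorem sum_card_planeSection (f : MvPolynomial (Fin n) K) :
    ∑ φ : (Fin n → K) × (Fin n → K) × (Fin n → K),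
        (Finset.univ.filter fun st : K × K ↦
          MvPolynomial.eval (fun i ↦ φ.1 i + φ.2.1 i * st.1 + φ.2.2 i * st.2) f = 0).card =
      Fintype.card K ^ (2 * n + 2) * rationalPointCount f := by
  set q := Fintype.card K with hq
  set N := rationalPointCount f with hN
  -- sum over `p` first
  have hinner : ∀ (v w : Fin n → K) (st : K × K),
      (Finset.univ.filter fun p : Fin n → K ↦
        MvPolynomial.eval (fun i ↦ p i + v i * st.1 + w i * st.2) f = 0).card = N := by
    intro v w st
    have : (Finset.univ.filter fun p : Fin n → K ↦
        MvPolynomial.eval (fun i ↦ p i + v i * st.1 + w i * st.2) f = 0) =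
        Finset.univ.filter fun p : Fin n → K ↦
          MvPolynomial.eval (p + fun i ↦ v i * st.1 + w i * st.2) f = 0 := by
      refine Finset.filter_congr fun p _ ↦ ?_
      have : (fun i ↦ p i + v i * st.1 + w i * st.2) = p + fun i ↦ v i * st.1 + w i * st.2 := by
        funext i
        simp only [Pi.add_apply, add_assoc]
      rw [this]
    rw [this, card_filter_eval_add_eq]
    rfl
  calc ∑ φ : (Fin n → K) × (Fin n → K) × (Fin n → K),
        (Finset.univ.filter fun st : K × K ↦
          MvPolynomial.eval (fun i ↦ φ.1 i + φ.2.1 i * st.1 + φ.2.2 i * st.2) f = 0).card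
      = ∑ φ : (Fin n → K) × (Fin n → K) × (Fin n → K), ∑ st : K × K,
          (if MvPolynomial.eval (fun i ↦ φ.1 i + φ.2.1 i * st.1 + φ.2.2 i * st.2) f = 0
            then 1 else 0) := by
        refine Finset.sum_congr rfl fun φ _ ↦ ?_
        rw [Finset.card_filter]
    _ = ∑ vw : (Fin n → K) × (Fin n → K), ∑ st : K × K, ∑ p : Fin n → K,
          (if MvPolynomial.eval (fun i ↦ p i + vw.1 i * st.1 + vw.2 i * st.2) f = 0
            then 1 else 0) := by
        rw [Fintype.sum_prod_type, Finset.sum_comm]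
        refine Finset.sum_congr rfl fun vw _ ↦ ?_
        rw [Finset.sum_comm]
    _ = ∑ _vw : (Fin n → K) × (Fin n → K), ∑ _st : K × K, N := by
        refine Finset.sum_congr rfl fun vw _ ↦ Finset.sum_congr rfl fun st _ ↦ ?_
        rw [← Finset.card_filter]
        exact hinner vw.1 vw.2 st
    _ = q ^ (2 * n + 2) * N := by
        simp only [Finset.sum_const, Finset.card_univ, smul_eq_mul, Fintype.card_prod,
          Fintype.card_fun, Fintype.card_fin, ← hq]
        ring

/-- **The averaging inequality (Cafure–Matera (21), parametrised):**
`q^{2n+2} |N - q^{n-1}| ≤ ∑_φ |N_φ - q|`. [cite: CafureMatera2006, §5.1 (21)] -/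
theorem mul_abs_sub_le_sum (hn : 1 ≤ n) (f : MvPolynomial (Fin n) K) :
    (Fintype.card K : ℝ) ^ (2 * n + 2) *
        |(rationalPointCount f : ℝ) - (Fintype.card K : ℝ) ^ (n - 1)| ≤
      ∑ φ : (Fin n → K) × (Fin n → K) × (Fin n → K),
        |((Finset.univ.filter fun st : K × K ↦
            MvPolynomial.eval (fun i ↦ φ.1 i + φ.2.1 i * st.1 + φ.2.2 i * st.2) f = 0).card : ℝ) -
          Fintype.card K| := by
  set q := Fintype.card K with hq
  have hsum := sum_card_planeSection f
  rw [← hq] at hsum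
  have hsumR : (∑ φ : (Fin n → K) × (Fin n → K) × (Fin n → K),
      ((Finset.univ.filter fun st : K × K ↦
        MvPolynomial.eval (fun i ↦ φ.1 i + φ.2.1 i * st.1 + φ.2.2 i * st.2) f = 0).card : ℝ)) =
      (q : ℝ) ^ (2 * n + 2) * rationalPointCount f := by
    exact_mod_cast hsum
  have hcard : (Finset.univ : Finset ((Fin n → K) × (Fin n → K) × (Fin n → K))).card =
      q ^ (3 * n) := by
    simp only [Finset.card_univ, Fintype.card_prod, Fintype.card_fun, Fintype.card_fin, ← hq]
    ring
  have hconst : (∑ _φ : (Fin n → K) × (Fin n → K) × (Fin n → K), (q : ℝ)) =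
      (q : ℝ) ^ (2 * n + 2) * (q : ℝ) ^ (n - 1) := by
    rw [Finset.sum_const, hcard, nsmul_eq_mul]
    push_cast
    rw [← pow_succ, ← pow_add]
    congr 1
    omega
  have hq0 : (0 : ℝ) ≤ (q : ℝ) ^ (2 * n + 2) := by positivity
  rw [← abs_of_nonneg hq0, ← abs_mul, mul_sub, ← hsumR, ← hconst, ← Finset.sum_sub_distrib]
  exact Finset.abs_sum_le_sum_abs _ _

/-! ### The sections vanishing identically and the degenerate parameters -/

/-- **At most `δ² q^{3n-2}` sections vanish identically** (`f ≠ 0` of degree `δ`, `n ≥ 1`): a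
vanishing section `f(p + Xv + Yw) = 0` has `f(p) = 0` (at most `δ q^{n-1}` such `p`, Lemma 2.1)
and `f_δ(w) = 0` (at most `δ q^{n-1}` such `w`, Lemma 2.1 for the non-zero form `f_δ` of degree
`δ`). This replaces the `C`-term (18) of Cafure–Matera. [cite: CafureMatera2006, Lemma 2.1, (18)] -/
theorem card_filter_planeSection_pvw_eq_zero_le {f : MvPolynomial (Fin n) K} (hf : f ≠ 0) :
    (Finset.univ.filter fun φ : (Fin n → K) × (Fin n → K) × (Fin n → K) ↦
        sec[f, φ.1, φ.2.1, φ.2.2] = 0).card ≤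
      (f.totalDegree * Fintype.card K ^ (n - 1)) * Fintype.card K ^ n *
        (f.totalDegree * Fintype.card K ^ (n - 1)) := by
  set δ := f.totalDegree with hδ
  set fδ := MvPolynomial.homogeneousComponent δ f with hfδ
  have hfδ0 : fδ ≠ 0 := homogeneousComponent_totalDegree_ne_zero hf
  have hfδdeg : fδ.totalDegree = δ :=
    (MvPolynomial.homogeneousComponent_isHomogeneous δ f).totalDegree hfδ0
  set Zp := (Finset.univ : Finset (Fin n → K)).filter fun x ↦ MvPolynomial.eval x f = 0 with hZp
  set Zw := (Finset.univ : Finset (Fin n → K)).filter fun x ↦ MvPolynomial.eval x fδ = 0 with hZw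
  have hZp : Zp.card ≤ δ * Fintype.card K ^ (n - 1) := rationalPointCount_le_totalDegree_mul hf
  have hZw : Zw.card ≤ δ * Fintype.card K ^ (n - 1) := by
    have := rationalPointCount_le_totalDegree_mul hfδ0
    rwa [hfδdeg] at this
  calc (Finset.univ.filter fun φ : (Fin n → K) × (Fin n → K) × (Fin n → K) ↦
          sec[f, φ.1, φ.2.1, φ.2.2] = 0).card
      ≤ (Zp ×ˢ ((Finset.univ : Finset (Fin n → K)) ×ˢ Zw)).card := by
        refine Finset.card_le_card fun φ hφ ↦ ?_
        rw [Finset.mem_filter] at hφ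
        obtain ⟨h1, h2⟩ := eval_eq_zero_and_of_planeSection_eq_zero hφ.2
        rw [Finset.mem_product, Finset.mem_product]
        exact ⟨Finset.mem_filter.2 ⟨Finset.mem_univ _, h1⟩, Finset.mem_univ _,
          Finset.mem_filter.2 ⟨Finset.mem_univ _, h2⟩⟩
    _ = Zp.card * (Fintype.card K ^ n * Zw.card) := by
        rw [Finset.card_product, Finset.card_product, Finset.card_univ, Fintype.card_fun,
          Fintype.card_fin]
    _ ≤ (δ * Fintype.card K ^ (n - 1)) * (Fintype.card K ^ n * (δ * Fintype.card K ^ (n - 1))) :=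
        Nat.mul_le_mul hZp (Nat.mul_le_mul_left _ hZw)
    _ = _ := by ring

/-- **At most `(q + 1) q^{2n}` degenerate parameters:** if `v, w` are linearly dependent then
`v = 0` or `w ∈ Kv`. (The `D`-term (19) of Cafure–Matera.) [folklore] -/
theorem card_filter_not_linearIndependent_le :
    (Finset.univ.filter fun φ : (Fin n → K) × (Fin n → K) × (Fin n → K) ↦
        ¬ LinearIndependent K ![φ.2.1, φ.2.2]).card ≤
      Fintype.card K ^ n * (Fintype.card K ^ n + Fintype.card K ^ n * Fintype.card K) := by
  set q := Fintype.card K with hq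
  -- the dependent pairs `(v, w)`
  set Dvw := (Finset.univ : Finset ((Fin n → K) × (Fin n → K))).filter
    fun vw ↦ ¬ LinearIndependent K ![vw.1, vw.2] with hDvw
  have hDvw_sub : Dvw ⊆ ({(0 : Fin n → K)} ×ˢ (Finset.univ : Finset (Fin n → K))) ∪
      (Finset.univ : Finset (Fin n → K)).biUnion
        fun v ↦ (Finset.univ : Finset K).image fun a ↦ (v, a • v) := by
    intro vw hvw
    rw [Finset.mem_filter, LinearIndependent.pair_iff] at hvw
    push Not at hvw
    obtain ⟨s, t, hst, hne⟩ := hvw.2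
    rw [Finset.mem_union, Finset.mem_product, Finset.mem_singleton, Finset.mem_biUnion]
    by_cases ht : t = 0
    · left
      have hs : s ≠ 0 := fun hs ↦ hne hs ht
      rw [ht, zero_smul, add_zero, smul_eq_zero, or_iff_right hs] at hst
      exact ⟨hst, Finset.mem_univ _⟩
    · right
      have h1 : t • vw.2 = -(s • vw.1) := eq_neg_of_add_eq_zero_right hst
      have h2 : vw.2 = (-(t⁻¹ * s)) • vw.1 := by
        calc vw.2 = t⁻¹ • (t • vw.2) := by rw [smul_smul, inv_mul_cancel₀ ht, one_smul]
          _ = t⁻¹ • (-(s • vw.1)) := by rw [h1]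
          _ = (-(t⁻¹ * s)) • vw.1 := by rw [smul_neg, smul_smul, neg_smul]
      refine ⟨vw.1, Finset.mem_univ _, Finset.mem_image.2 ⟨-(t⁻¹ * s), Finset.mem_univ _, ?_⟩⟩
      exact Prod.ext rfl h2.symm
  have hDvw_card : Dvw.card ≤ q ^ n + q ^ n * q := by
    refine (Finset.card_le_card hDvw_sub).trans ((Finset.card_union_le _ _).trans ?_)
    refine Nat.add_le_add ?_ ?_
    · rw [Finset.card_product, Finset.card_singleton, one_mul, Finset.card_univ, Fintype.card_fun,
        Fintype.card_fin]
    · refine Finset.card_biUnion_le.trans ?_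
      calc ∑ v : Fin n → K, ((Finset.univ : Finset K).image fun a ↦ (v, a • v)).card
          ≤ ∑ _v : Fin n → K, q := Finset.sum_le_sum fun v _ ↦
            Finset.card_image_le.trans (by rw [Finset.card_univ])
        _ = q ^ n * q := by
            rw [Finset.sum_const, Finset.card_univ, Fintype.card_fun, Fintype.card_fin,
              smul_eq_mul]
  -- the parameters `(p, v, w)` with `(v, w)` dependent
  have hsub : (Finset.univ.filter fun φ : (Fin n → K) × (Fin n → K) × (Fin n → K) ↦
      ¬ LinearIndependent K ![φ.2.1, φ.2.2]) ⊆
      (Finset.univ : Finset (Fin n → K)) ×ˢ Dvw := by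
    intro φ hφ
    rw [Finset.mem_filter] at hφ
    rw [Finset.mem_product, hDvw, Finset.mem_filter]
    exact ⟨Finset.mem_univ _, Finset.mem_univ _, hφ.2⟩
  refine (Finset.card_le_card hsub).trans ?_
  rw [Finset.card_product, Finset.card_univ, Fintype.card_fun, Fintype.card_fin]
  exact Nat.mul_le_mul_left _ hDvw_card

/-! ### The averaging inequality with the plane-curve estimates plugged in -/

/-- **Cafure–Matera (21)–(22), parametrised, with Weil's estimate plugged in.** Let `K = 𝔽_q`,
`n ≥ 1`, `f ∈ K[X₁, …, Xₙ]` non-zero of degree `δ ≥ 2`, `N = #{f = 0}`. Sorting the parameters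
`φ = (p, v, w) ∈ (Kⁿ)³` into (i) `f_φ = 0` (at most `δ² q^{3n-2}`, each with `|N_φ - q| ≤ q²`),
(ii) `v, w` dependent (at most `(q+1)q^{2n}`, each with `|N_φ - q| ≤ δq`), (iii) `f_φ` absolutely
irreducible (`|N_φ - q| ≤ ω`, **P1**) and (iv) the remaining "bad" ones
(`|N_φ - q| ≤ max(1, m(f_φ) - 1) q + ω`, **P2**), the averaging inequality gives
`q^{2n+2} |N - q^{n-1}| ≤ q^{3n} ω + q B + q² · δ² q^{3n-2} + δ q · (q+1) q^{2n}` with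
`ω = (δ-1)(δ-2)√q + δ³` and `B = ∑_{φ bad} max(1, m(f_φ) - 1)` — the weighted count of bad
parameters that the effective Bertini theorem (Cafure–Matera Prop. 4.1) bounds by
`(2δ^{13/3} + 3δ^{11/3}) q^{3n-1}`. [cite: CafureMatera2006, §5.1 (21)–(22)] -/
theorem mul_abs_sub_le_of_planeSections (hn : 1 ≤ n) {f : MvPolynomial (Fin n) K} (hf : f ≠ 0)
    {δ : ℕ} (hδ : f.totalDegree = δ) (hδ2 : 2 ≤ δ) :
    (Fintype.card K : ℝ) ^ (2 * n + 2) *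
        |(rationalPointCount f : ℝ) - (Fintype.card K : ℝ) ^ (n - 1)| ≤
      (Fintype.card K : ℝ) ^ (3 * n) *
          (((δ - 1) * (δ - 2) : ℕ) * √(Fintype.card K : ℝ) + (δ : ℝ) ^ 3) +
        (Fintype.card K : ℝ) *
          ∑ φ ∈ (Finset.univ.filter fun φ : (Fin n → K) × (Fin n → K) × (Fin n → K) ↦
              LinearIndependent K ![φ.2.1, φ.2.2] ∧ sec[f, φ.1, φ.2.1, φ.2.2] ≠ 0 ∧
                ¬ Irreducible ((sec[f, φ.1, φ.2.1, φ.2.2]).map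
                  (mapRingHom (algebraMap K (AlgebraicClosure K))))),
            ((max 1 ((UniqueFactorizationMonoid.normalizedFactors
              (sec[f, φ.1, φ.2.1, φ.2.2])).toFinset.card - 1) : ℕ) : ℝ) +
        (Fintype.card K : ℝ) ^ 2 *
          ((f.totalDegree * Fintype.card K ^ (n - 1)) * Fintype.card K ^ n *
            (f.totalDegree * Fintype.card K ^ (n - 1)) : ℕ) +
        (δ : ℝ) * Fintype.card K *
          ((Fintype.card K ^ n * (Fintype.card K ^ n + Fintype.card K ^ n * Fintype.card K)) : ℕ) := by
  set q := Fintype.card K with hq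
  set ω : ℝ := ((δ - 1) * (δ - 2) : ℕ) * √(q : ℝ) + (δ : ℝ) ^ 3 with hω
  set σ := algebraMap K (AlgebraicClosure K) with hσ
  have hq0 : (0 : ℝ) ≤ q := Nat.cast_nonneg _
  have hq1 : (1 : ℝ) ≤ q := by exact_mod_cast Fintype.card_pos
  have hsq : 0 ≤ √(q : ℝ) := Real.sqrt_nonneg _
  have hω0 : 0 ≤ ω := by positivity
  have hδ1 : 1 ≤ δ := by omega
  have hδr : (1 : ℝ) ≤ δ := by exact_mod_cast hδ1
  -- the classes of parameters
  set Φ := (Finset.univ : Finset ((Fin n → K) × (Fin n → K) × (Fin n → K))) with hΦ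
  set Z0 := Φ.filter fun φ ↦ sec[f, φ.1, φ.2.1, φ.2.2] = 0 with hZ0
  set D := Φ.filter fun φ ↦ ¬ LinearIndependent K ![φ.2.1, φ.2.2] with hD
  set Bad := Φ.filter fun φ ↦ LinearIndependent K ![φ.2.1, φ.2.2] ∧
      sec[f, φ.1, φ.2.1, φ.2.2] ≠ 0 ∧
      ¬ Irreducible ((sec[f, φ.1, φ.2.1, φ.2.2]).map (mapRingHom σ)) with hBad
  set jw : (Fin n → K) × (Fin n → K) × (Fin n → K) → ℕ := fun φ ↦
    max 1 ((UniqueFactorizationMonoid.normalizedFactors (sec[f, φ.1, φ.2.1, φ.2.2])).toFinset.card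
      - 1) with hjw
  -- the number of zeros of a section
  set Nφ : (Fin n → K) × (Fin n → K) × (Fin n → K) → ℕ := fun φ ↦
    (Finset.univ.filter fun st : K × K ↦ (sec[f, φ.1, φ.2.1, φ.2.2]).evalEval st.1 st.2 = 0).card
    with hNφ
  have hNφ_eval : ∀ φ : (Fin n → K) × (Fin n → K) × (Fin n → K),
      (Finset.univ.filter fun st : K × K ↦
        MvPolynomial.eval (fun i ↦ φ.1 i + φ.2.1 i * st.1 + φ.2.2 i * st.2) f = 0).card = Nφ φ := by
    intro φ
    refine congrArg Finset.card (Finset.filter_congr fun st _ ↦ ?_)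
    rw [evalEval_planeSection]
  -- the pointwise bounds
  have hTD : ∀ φ : (Fin n → K) × (Fin n → K) × (Fin n → K), ∀ k j, δ < j + k →
      ((sec[f, φ.1, φ.2.1, φ.2.2]).coeff k).coeff j = 0 := fun φ ↦
    hδ ▸ coeff_coeff_planeSection_eq_zero f φ.1 φ.2.1 φ.2.2
  have hpt : ∀ φ : (Fin n → K) × (Fin n → K) × (Fin n → K),
      |(Nφ φ : ℝ) - q| ≤
        (if sec[f, φ.1, φ.2.1, φ.2.2] = 0 then (q : ℝ) ^ 2 else 0) +
          (if ¬ LinearIndependent K ![φ.2.1, φ.2.2] then (δ : ℝ) * q else 0) + ω +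
          (if φ ∈ Bad then (jw φ : ℝ) * q else 0) := by
    intro φ
    have hN0 : (0 : ℝ) ≤ Nφ φ := Nat.cast_nonneg _
    by_cases hsec : sec[f, φ.1, φ.2.1, φ.2.2] = 0
    · -- (i) the section vanishes: `N_φ = q²`
      have hN : Nφ φ = q * q := by
        simp only [hNφ, hsec, evalEval_zero, Finset.filter_true_of_mem,
          Finset.mem_univ, forall_true_iff, Finset.card_univ, Fintype.card_prod, ← hq]
      rw [if_pos hsec]
      have h1 : (0 : ℝ) ≤ (if ¬ LinearIndependent K ![φ.2.1, φ.2.2] then (δ : ℝ) * q else 0) := by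
        split_ifs <;> positivity
      have h2 : (0 : ℝ) ≤ (if φ ∈ Bad then (jw φ : ℝ) * q else 0) := by
        split_ifs <;> positivity
      have hN' : (Nφ φ : ℝ) = q * q := by exact_mod_cast hN
      rw [abs_le]
      constructor <;> nlinarith
    rw [if_neg hsec, zero_add]
    have hNle : Nφ φ ≤ δ * q := PlaneShear.card_filter_evalEval_le_mul hsec (hTD φ)
    have hNle' : (Nφ φ : ℝ) ≤ δ * q := by exact_mod_cast hNle
    by_cases hLI : LinearIndependent K ![φ.2.1, φ.2.2]
    · rw [if_neg (not_not.2 hLI), zero_add]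
      by_cases hirr : Irreducible ((sec[f, φ.1, φ.2.1, φ.2.2]).map (mapRingHom σ))
      · -- (iii) absolutely irreducible section: **P1**
        have hnot : φ ∉ Bad := by
          rw [hBad, Finset.mem_filter]; tauto
        rw [if_neg hnot, add_zero]
        exact PlaneShear.abs_card_zeros_sub_le_of_irreducible_map hδ2 (hTD φ) σ hirr
      · -- (iv) a bad parameter: **P2**
        have hmem : φ ∈ Bad := by
          rw [hBad, Finset.mem_filter]
          exact ⟨Finset.mem_univ _, hLI, hsec, hirr⟩
        rw [if_pos hmem]
        have hP2 := PlaneShear.card_zeros_le_card_factors_mul_add hδ1 hsec (hTD φ)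
        set m := (UniqueFactorizationMonoid.normalizedFactors
          (sec[f, φ.1, φ.2.1, φ.2.2])).toFinset.card with hm
        have hj1 : (1 : ℝ) ≤ jw φ := by exact_mod_cast le_max_left 1 (m - 1)
        have hjm : (m : ℝ) - 1 ≤ jw φ := by
          have : m - 1 ≤ jw φ := le_max_right 1 (m - 1)
          have h' : (m : ℝ) - 1 ≤ ((m - 1 : ℕ) : ℝ) := by
            rcases m with _ | m
            · simp
            · push_cast; linarith
          exact h'.trans (by exact_mod_cast this)
        rw [abs_le]
        constructor <;> nlinarith
    · -- (ii) degenerate parameters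
      rw [if_pos hLI]
      have h2 : (0 : ℝ) ≤ (if φ ∈ Bad then (jw φ : ℝ) * q else 0) := by
        split_ifs <;> positivity
      rw [abs_le]
      constructor <;> nlinarith
  -- summing
  have hsum := mul_abs_sub_le_sum hn f
  rw [← hq] at hsum
  refine hsum.trans ?_
  calc ∑ φ : (Fin n → K) × (Fin n → K) × (Fin n → K),
        |((Finset.univ.filter fun st : K × K ↦
          MvPolynomial.eval (fun i ↦ φ.1 i + φ.2.1 i * st.1 + φ.2.2 i * st.2) f = 0).card : ℝ) - q|
      = ∑ φ : (Fin n → K) × (Fin n → K) × (Fin n → K), |(Nφ φ : ℝ) - q| := by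
        refine Finset.sum_congr rfl fun φ _ ↦ ?_
        rw [hNφ_eval]
    _ ≤ ∑ φ : (Fin n → K) × (Fin n → K) × (Fin n → K),
        ((if sec[f, φ.1, φ.2.1, φ.2.2] = 0 then (q : ℝ) ^ 2 else 0) +
          (if ¬ LinearIndependent K ![φ.2.1, φ.2.2] then (δ : ℝ) * q else 0) + ω +
          (if φ ∈ Bad then (jw φ : ℝ) * q else 0)) := Finset.sum_le_sum fun φ _ ↦ hpt φ
    _ = (q : ℝ) ^ 2 * Z0.card + (δ : ℝ) * q * D.card + (q : ℝ) ^ (3 * n) * ω +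
          q * ∑ φ ∈ Bad, (jw φ : ℝ) := by
        rw [Finset.sum_add_distrib, Finset.sum_add_distrib, Finset.sum_add_distrib]
        congr 1
        · congr 1
          · congr 1
            · rw [← Finset.sum_filter, Finset.sum_const, nsmul_eq_mul, mul_comm]
            · rw [← Finset.sum_filter, Finset.sum_const, nsmul_eq_mul, mul_comm]
          · rw [Finset.sum_const, nsmul_eq_mul, Finset.card_univ, Fintype.card_prod,
              Fintype.card_prod, Fintype.card_fun, Fintype.card_fin, ← hq]
            congr 1
            push_cast
            ring
        · rw [← Finset.sum_filter, Finset.mul_sum]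
          refine Finset.sum_congr ?_ fun φ _ ↦ mul_comm _ _
          ext φ
          simp [hBad]
    _ ≤ _ := by
        have hZ0 : (Z0.card : ℝ) ≤ ((f.totalDegree * q ^ (n - 1)) * q ^ n *
            (f.totalDegree * q ^ (n - 1)) : ℕ) := by
          exact_mod_cast card_filter_planeSection_pvw_eq_zero_le hf
        have hDc : (D.card : ℝ) ≤ ((q ^ n * (q ^ n + q ^ n * q)) : ℕ) := by
          exact_mod_cast card_filter_not_linearIndependent_le (K := K) (n := n)
        have hδq : (0 : ℝ) ≤ (δ : ℝ) * q := by positivity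
        nlinarith [mul_le_mul_of_nonneg_left hZ0 (sq_nonneg (q : ℝ)),
          mul_le_mul_of_nonneg_left hDc hδq]

end Literature.NumberTheory.DiophantineGeometry

/-! ## Part 2: assembly (Theorem 5.2 from a bad-plane bound) -/

open scoped Classical Polynomial.Bivariate

namespace Literature.NumberTheory.DiophantineGeometry

universe u

/-- The plane section `f(p + Xv + Yw) ∈ K[X][Y]` (local notation, as in
`CafureMateraAveragingProofs`). -/
local notation3 (prettyPrint := false) "sec[" K ", " f ", " p ", " v ", " w "]" =>
  (MvPolynomial.aeval (R := K) (fun i ↦ Polynomial.C (Polynomial.C (w i)) * Polynomial.X +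
      Polynomial.C (Polynomial.C (p i) + Polynomial.C (v i) * Polynomial.X)) f)

/-! ### Small dimensions -/

section SmallDim

variable {K : Type u} [Field K]

/-- Over `Fin 0` no polynomial is absolutely irreducible (they are constants). [folklore] -/
theorem not_isAbsIrreducible_fin_zero (f : MvPolynomial (Fin 0) K) : ¬ IsAbsIrreducible f := by
  intro hf
  have h := hf.totalDegree_pos
  rw [f.eq_C_of_isEmpty, MvPolynomial.totalDegree_C] at h
  exact lt_irrefl 0 h

/-- For a one-variable polynomial the total degree is the degree in the variable. [folklore] -/
theorem totalDegree_eq_degreeOf_fin_one {R : Type*} [CommSemiring R] (p : MvPolynomial (Fin 1) R) :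
    p.totalDegree = p.degreeOf 0 := by
  rw [MvPolynomial.totalDegree, MvPolynomial.degreeOf_eq_sup]
  congr 1
  funext s
  rw [Finsupp.sum_fintype _ _ (fun _ ↦ rfl), Fin.sum_univ_one]

/-- **An absolutely irreducible polynomial in one variable is linear.** [folklore] -/
theorem totalDegree_eq_one_of_isAbsIrreducible_fin_one {f : MvPolynomial (Fin 1) K}
    (hf : IsAbsIrreducible f) : f.totalDegree = 1 := by
  set L := AlgebraicClosure K with hL
  set g : MvPolynomial (Fin 1) L := MvPolynomial.map (algebraMap K L) f with hg
  have hgirr : Irreducible g := hf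
  set e₁ := MvPolynomial.finSuccEquiv L 0 with he₁
  set e₂ : Polynomial (MvPolynomial (Fin 0) L) ≃ₐ[L] Polynomial L :=
    Polynomial.mapAlgEquiv (MvPolynomial.isEmptyAlgEquiv L (Fin 0)) with he₂
  have hirr : Irreducible (e₂ (e₁ g)) :=
    (MulEquiv.irreducible_iff e₂.toMulEquiv).2 ((MulEquiv.irreducible_iff e₁.toMulEquiv).2 hgirr)
  have hdeg : (e₂ (e₁ g)).natDegree = 1 := by
    have := IsAlgClosed.degree_eq_one_of_irreducible L hirr
    exact Polynomial.natDegree_eq_of_degree_eq_some this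
  have h1 : (e₂ (e₁ g)).natDegree = (e₁ g).natDegree := by
    rw [he₂, Polynomial.coe_mapAlgEquiv]
    exact Polynomial.natDegree_map_eq_of_injective
      (MvPolynomial.isEmptyAlgEquiv L (Fin 0)).injective _
  rw [h1, he₁, MvPolynomial.natDegree_finSuccEquiv, ← totalDegree_eq_degreeOf_fin_one] at hdeg
  -- `deg (map f) = deg f`
  have hfg : f.totalDegree = g.totalDegree := by
    rw [hg, MvPolynomial.totalDegree, MvPolynomial.totalDegree,
      MvPolynomial.support_map_of_injective _ (algebraMap K L).injective]
  rw [hfg]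
  exact hdeg

/-- Base change commutes with `equivMvPolynomial.symm`. [folklore] -/
theorem equivMvPolynomial_symm_map {L : Type*} [CommRing L] (σ : K →+* L)
    (f : MvPolynomial (Fin 2) K) :
    (Polynomial.Bivariate.equivMvPolynomial L).symm (MvPolynomial.map σ f) =
      ((Polynomial.Bivariate.equivMvPolynomial K).symm f).map (Polynomial.mapRingHom σ) := by
  have h : ((Polynomial.Bivariate.equivMvPolynomial L).symm : MvPolynomial (Fin 2) L →+* L[X][Y]).comp
      (MvPolynomial.map σ) =
      (Polynomial.mapRingHom (Polynomial.mapRingHom σ)).comp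
        ((Polynomial.Bivariate.equivMvPolynomial K).symm : MvPolynomial (Fin 2) K →+* K[X][Y]) := by
    refine MvPolynomial.ringHom_ext (fun a ↦ ?_) (fun i ↦ ?_)
    · simp
    · fin_cases i <;> simp
  exact congrArg (fun φ : MvPolynomial (Fin 2) K →+* L[X][Y] ↦ φ f) h

variable [Fintype K]

/-- **Theorem 5.2 for plane curves (`n = 2`)**, directly from **P1**: for `f ∈ K[X₀, X₁]`
absolutely irreducible of degree `δ ≥ 2`, `|#{f = 0} - q| ≤ (δ-1)(δ-2)√q + δ³`.
[cite: CafureMatera2006, Thm. 5.2 (n = 2) and eq. (1.2)] -/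
theorem abs_rationalPointCount_sub_le_fin_two {f : MvPolynomial (Fin 2) K} (hf : IsAbsIrreducible f)
    (hδ2 : 2 ≤ f.totalDegree) :
    |(rationalPointCount f : ℝ) - Fintype.card K| ≤
      ((f.totalDegree - 1) * (f.totalDegree - 2) : ℕ) * √(Fintype.card K : ℝ) +
        (f.totalDegree : ℝ) ^ 3 := by
  set P : K[X][Y] := (Polynomial.Bivariate.equivMvPolynomial K).symm f with hP
  have hTD : ∀ k j, f.totalDegree < j + k → (P.coeff k).coeff j = 0 := fun k j h ↦
    Dioph.coeff_coeff_symm_eq_zero f h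
  set σ := algebraMap K (AlgebraicClosure K) with hσ
  have hirr : Irreducible (P.map (Polynomial.mapRingHom σ)) := by
    rw [hP, ← equivMvPolynomial_symm_map]
    exact (MulEquiv.irreducible_iff
      (Polynomial.Bivariate.equivMvPolynomial (AlgebraicClosure K)).symm.toMulEquiv).2 hf
  have hcount : (Finset.univ.filter fun p : K × K ↦ P.evalEval p.1 p.2 = 0).card =
      rationalPointCount f := by
    rw [PlaneShear.card_filter_evalEval_eq_rationalPointCount, hP, AlgEquiv.apply_symm_apply]
  have h := PlaneShear.abs_card_zeros_sub_le_of_irreducible_map hδ2 hTD σ hirr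
  rwa [hcount] at h

end SmallDim

/-! ### The numerical comparison `δ³ + δ² + 1 + 3δ^{11/3} ≤ 3δ^{13/3}` -/

/-- For `δ ≥ 2`: `δ³ + δ² + 1 + 3 δ^{11/3} ≤ 3 δ^{13/3}` (substitute `δ = x³`, `x ≥ 5/4`).
[folklore] -/
theorem numeric_thm52 {δ : ℝ} (hδ : 2 ≤ δ) :
    δ ^ 3 + δ ^ 2 + 1 + 3 * δ ^ ((11 : ℝ) / 3) ≤ 3 * δ ^ ((13 : ℝ) / 3) := by
  have hδ0 : 0 ≤ δ := by linarith
  set x := δ ^ ((1 : ℝ) / 3) with hx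
  have hx0 : 0 ≤ x := Real.rpow_nonneg hδ0 _
  have hx3 : x ^ 3 = δ := by
    rw [hx, ← Real.rpow_natCast, ← Real.rpow_mul hδ0]
    norm_num
  have h11 : δ ^ ((11 : ℝ) / 3) = x ^ 11 := by
    rw [hx, ← Real.rpow_natCast, ← Real.rpow_mul hδ0]
    norm_num
  have h13 : δ ^ ((13 : ℝ) / 3) = x ^ 13 := by
    rw [hx, ← Real.rpow_natCast, ← Real.rpow_mul hδ0]
    norm_num
  have hx54 : (5 : ℝ) / 4 ≤ x := by
    by_contra hlt
    rw [not_le] at hlt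
    have : x ^ 3 < ((5 : ℝ) / 4) ^ 3 := pow_lt_pow_left₀ hlt hx0 (by norm_num)
    rw [hx3] at this
    norm_num at this
    linarith
  rw [h11, h13, ← hx3]
  have h2 : (25 : ℝ) / 16 ≤ x ^ 2 := by nlinarith
  have hx9 : 0 ≤ x ^ 9 := pow_nonneg hx0 9
  have hx11 : 0 ≤ x ^ 11 := pow_nonneg hx0 11
  have hx6 : 0 ≤ x ^ 6 := pow_nonneg hx0 6
  have hA : (25 : ℝ) / 16 * x ^ 11 ≤ x ^ 13 := by
    have := mul_le_mul_of_nonneg_left h2 hx11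
    calc (25 : ℝ) / 16 * x ^ 11 = x ^ 11 * (25 / 16) := by ring
      _ ≤ x ^ 11 * x ^ 2 := this
      _ = x ^ 13 := by ring
  have hB : (25 : ℝ) / 16 * x ^ 9 ≤ x ^ 11 := by
    have := mul_le_mul_of_nonneg_left h2 hx9
    calc (25 : ℝ) / 16 * x ^ 9 = x ^ 9 * (25 / 16) := by ring
      _ ≤ x ^ 9 * x ^ 2 := this
      _ = x ^ 11 := by ring
  have hC : x ^ 6 ≤ x ^ 9 := by
    have h3 : (1 : ℝ) ≤ x ^ 3 := by nlinarith
    have := mul_le_mul_of_nonneg_left h3 hx6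
    calc x ^ 6 = x ^ 6 * 1 := by ring
      _ ≤ x ^ 6 * x ^ 3 := this
      _ = x ^ 9 := by ring
  have hD : ((5 : ℝ) / 4) ^ 9 ≤ x ^ 9 := pow_le_pow_left₀ (by norm_num) hx54 9
  nlinarith

/-! ### The main case `n ≥ 3` -/

section Main

variable {K : Type} [Field K] [Fintype K]

/-- **Theorem 5.2 for `n ≥ 3` from a bound on the weighted number of bad planes.** Let
`f ∈ 𝔽_q[X₁, …, X_{m+3}]` be absolutely irreducible of degree `δ ≥ 2` with `2δ + 1 ≤ q`, and
suppose the weighted number `B = ∑_{φ bad} max(1, m(f_φ) - 1)` of parametrised planes whose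
section is non-zero but not absolutely irreducible is at most `c_B q^{3(m+3)-1}`. Then
`|#{f = 0} - q^{m+2}| ≤ q^{m+1} ((δ-1)(δ-2)√q + δ³ + δ² + 1 + c_B)` (from
`mul_abs_sub_le_of_planeSections`). [cite: CafureMatera2006, proof of Thm. 5.2, (22)] -/
theorem abs_rationalPointCount_sub_le_of_bad_le {m : ℕ} {f : MvPolynomial (Fin (m + 3)) K}
    (hf : IsAbsIrreducible f) {δ : ℕ} (hδ : f.totalDegree = δ) (hδ2 : 2 ≤ δ)
    (hq : 2 * δ + 1 ≤ Fintype.card K) (cB : ℝ)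
    (hB : (∑ φ ∈ (Finset.univ.filter
        fun φ : (Fin (m + 3) → K) × (Fin (m + 3) → K) × (Fin (m + 3) → K) ↦
          LinearIndependent K ![φ.2.1, φ.2.2] ∧ sec[K, f, φ.1, φ.2.1, φ.2.2] ≠ 0 ∧
            ¬ Irreducible ((sec[K, f, φ.1, φ.2.1, φ.2.2]).map
              (Polynomial.mapRingHom (algebraMap K (AlgebraicClosure K))))),
        ((max 1 ((UniqueFactorizationMonoid.normalizedFactors
          (sec[K, f, φ.1, φ.2.1, φ.2.2])).toFinset.card - 1) : ℕ) : ℝ)) ≤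
        cB * (Fintype.card K : ℝ) ^ (3 * (m + 3) - 1)) :
    |(rationalPointCount f : ℝ) - (Fintype.card K : ℝ) ^ (m + 2)| ≤
      (Fintype.card K : ℝ) ^ (m + 1) *
        (((δ - 1) * (δ - 2) : ℕ) * √(Fintype.card K : ℝ) + (δ : ℝ) ^ 3 + δ ^ 2 + 1 + cB) := by
  set q := Fintype.card K with hq_def
  have hq1 : (1 : ℝ) ≤ q := by exact_mod_cast Fintype.card_pos
  have hq0 : (0 : ℝ) < q := by linarith
  have hqδ : (2 : ℝ) * δ + 1 ≤ q := by exact_mod_cast hq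
  have hδr : (2 : ℝ) ≤ δ := by exact_mod_cast hδ2
  have h := mul_abs_sub_le_of_planeSections (n := m + 3) (by omega) hf.ne_zero hδ hδ2
  rw [← hq_def, hδ] at h
  rw [show m + 3 - 1 = m + 2 by omega] at h
  rw [show 3 * (m + 3) - 1 = 3 * m + 8 by omega] at hB
  -- normalise the error terms
  set ω : ℝ := ((δ - 1) * (δ - 2) : ℕ) * √(q : ℝ) + (δ : ℝ) ^ 3 with hω
  have hω0 : 0 ≤ ω := by positivity
  have hZ : (((δ * q ^ (m + 2)) * q ^ (m + 3) * (δ * q ^ (m + 2)) : ℕ) : ℝ) =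
      (δ : ℝ) ^ 2 * (q : ℝ) ^ (3 * m + 7) := by
    push_cast; ring
  have hD : (((q ^ (m + 3) * (q ^ (m + 3) + q ^ (m + 3) * q)) : ℕ) : ℝ) =
      (q : ℝ) ^ (2 * m + 6) * (1 + q) := by
    push_cast; ring
  rw [hZ, hD] at h
  -- `δ(1+q) q^{2m+7} ≤ q^{3m+9}`
  have hsmall : (δ : ℝ) * q * ((q : ℝ) ^ (2 * m + 6) * (1 + q)) ≤ (q : ℝ) ^ (3 * (m + 3)) := by
    have h1 : (δ : ℝ) * (1 + q) ≤ q ^ 2 := by nlinarith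
    have h2 : (q : ℝ) ^ 2 ≤ q ^ (m + 2) := pow_le_pow_right₀ hq1 (by omega)
    have h3 : (0 : ℝ) ≤ (q : ℝ) ^ (2 * m + 7) := by positivity
    calc (δ : ℝ) * q * ((q : ℝ) ^ (2 * m + 6) * (1 + q))
        = (q : ℝ) ^ (2 * m + 7) * ((δ : ℝ) * (1 + q)) := by ring
      _ ≤ (q : ℝ) ^ (2 * m + 7) * q ^ (m + 2) := mul_le_mul_of_nonneg_left (h1.trans h2) h3
      _ = (q : ℝ) ^ (3 * (m + 3)) := by rw [← pow_add]; congr 1; omega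
  -- collect
  have hmain : (q : ℝ) ^ (2 * (m + 3) + 2) * |(rationalPointCount f : ℝ) - (q : ℝ) ^ (m + 2)| ≤
      (q : ℝ) ^ (2 * (m + 3) + 2) * ((q : ℝ) ^ (m + 1) * (ω + δ ^ 2 + 1 + cB)) := by
    refine h.trans ?_
    have hBq : (q : ℝ) * ∑ φ ∈ (Finset.univ.filter
        fun φ : (Fin (m + 3) → K) × (Fin (m + 3) → K) × (Fin (m + 3) → K) ↦
          LinearIndependent K ![φ.2.1, φ.2.2] ∧ sec[K, f, φ.1, φ.2.1, φ.2.2] ≠ 0 ∧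
            ¬ Irreducible ((sec[K, f, φ.1, φ.2.1, φ.2.2]).map
              (Polynomial.mapRingHom (algebraMap K (AlgebraicClosure K))))),
        ((max 1 ((UniqueFactorizationMonoid.normalizedFactors
          (sec[K, f, φ.1, φ.2.1, φ.2.2])).toFinset.card - 1) : ℕ) : ℝ) ≤
        (q : ℝ) ^ (3 * (m + 3)) * cB := by
      calc _ ≤ (q : ℝ) * (cB * (q : ℝ) ^ (3 * m + 8)) := mul_le_mul_of_nonneg_left hB hq0.le
        _ = (q : ℝ) ^ (3 * (m + 3)) * cB := by ring
    have hZ' : (q : ℝ) ^ 2 * ((δ : ℝ) ^ 2 * (q : ℝ) ^ (3 * m + 7)) =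
        (q : ℝ) ^ (3 * (m + 3)) * δ ^ 2 := by ring
    have hid : (q : ℝ) ^ (2 * (m + 3) + 2) * ((q : ℝ) ^ (m + 1) * (ω + δ ^ 2 + 1 + cB)) =
        (q : ℝ) ^ (3 * (m + 3)) * ω + (q : ℝ) ^ (3 * (m + 3)) * cB +
          (q : ℝ) ^ (3 * (m + 3)) * δ ^ 2 + (q : ℝ) ^ (3 * (m + 3)) := by
      ring
    rw [hid, hZ']
    linarith
  have hpos : (0 : ℝ) < (q : ℝ) ^ (2 * (m + 3) + 2) := by positivity
  have := le_of_mul_le_mul_left hmain hpos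
  rw [hω] at this
  exact this

end Main

/-! ### The conditional theorem -/

/-- **Cafure–Matera (2006), Theorem 5.2, from a bound on the weighted number of bad planes
(general form).** Let `P` be a condition on the degree and `c_B(δ)` constants such that (i) for
every finite field, every `n ≥ 3` and every absolutely irreducible `f` of degree `δ ≥ 2` with
`P(δ)`, the weighted number `∑_{φ bad} max(1, m(f_φ) - 1)` of parametrised planes
`φ = (p, v, w)` (`v, w` independent) whose section `f(p + Xv + Yw)` is non-zero but not
absolutely irreducible is at most `c_B(δ) q^{3n-1}`, and (ii) `δ³ + δ² + 1 + c_B(δ) ≤ 5δ^{13/3}`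
whenever `δ ≥ 2` and `P(δ)`. Then the estimate of Theorem 5.2 holds for every absolutely
irreducible `f` whose degree satisfies `P`. (The cases `δ = 1`, `q ≤ 5δ^{10/3}`, `n ≤ 2` are
unconditional.) [cite: CafureMatera2006, proof of Thm. 5.2, (21)–(23)] -/
theorem CafureMatera2006_thm52_of_bad_le (P : ℕ → Prop) (cB : ℕ → ℝ)
    (hbad : ∀ (K : Type) [Field K] [Fintype K] (n : ℕ) (f : MvPolynomial (Fin n) K),
      IsAbsIrreducible f → 2 ≤ f.totalDegree → 3 ≤ n → P f.totalDegree →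
        (∑ φ ∈ (Finset.univ.filter fun φ : (Fin n → K) × (Fin n → K) × (Fin n → K) ↦
            LinearIndependent K ![φ.2.1, φ.2.2] ∧ sec[K, f, φ.1, φ.2.1, φ.2.2] ≠ 0 ∧
              ¬ Irreducible ((sec[K, f, φ.1, φ.2.1, φ.2.2]).map
                (Polynomial.mapRingHom (algebraMap K (AlgebraicClosure K))))),
          ((max 1 ((UniqueFactorizationMonoid.normalizedFactors
            (sec[K, f, φ.1, φ.2.1, φ.2.2])).toFinset.card - 1) : ℕ) : ℝ)) ≤
          cB f.totalDegree * (Fintype.card K : ℝ) ^ (3 * n - 1))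
    (hnum : ∀ δ : ℕ, 2 ≤ δ → P δ →
      (δ : ℝ) ^ 3 + δ ^ 2 + 1 + cB δ ≤ 5 * (δ : ℝ) ^ ((13 : ℝ) / 3))
    (K : Type) [Field K] [Fintype K] [DecidableEq K] (n : ℕ) (f : MvPolynomial (Fin n) K)
    (hf : IsAbsIrreducible f) (hP : P f.totalDegree) :
    |(rationalPointCount f : ℝ) - (Fintype.card K : ℝ) ^ ((n : ℝ) - 1)| ≤
      ((f.totalDegree : ℝ) - 1) * ((f.totalDegree : ℝ) - 2) *
          (Fintype.card K : ℝ) ^ ((n : ℝ) - 3 / 2) +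
        5 * (f.totalDegree : ℝ) ^ ((13 : ℝ) / 3) * (Fintype.card K : ℝ) ^ ((n : ℝ) - 2) := by
  -- all counts below are stated with the classical decidability instances
  obtain rfl : ‹DecidableEq K› = fun a b ↦ Classical.propDecidable (a = b) := Subsingleton.elim _ _
  -- `δ = 1`
  by_cases hδ1 : f.totalDegree = 1
  · exact CafureMatera2006_thm52_of_totalDegree_eq_one hδ1
  have hδ2 : 2 ≤ f.totalDegree := by have := hf.totalDegree_pos; omega
  -- the regime `q ≤ 5δ^{10/3}`
  by_cases hqsmall : (Fintype.card K : ℝ) ≤ 5 * (f.totalDegree : ℝ) ^ ((10 : ℝ) / 3)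
  · exact CafureMatera2006_thm52_of_card_le hf hqsmall
  rw [not_le] at hqsmall
  set q : ℝ := (Fintype.card K : ℝ) with hq
  set δ : ℕ := f.totalDegree with hδ
  have hq1 : (1 : ℝ) ≤ q := by rw [hq]; exact_mod_cast Fintype.card_pos
  have hq0 : 0 < q := by linarith
  have hδr : (2 : ℝ) ≤ δ := by exact_mod_cast hδ2
  have hδr1 : (1 : ℝ) ≤ δ := by linarith
  -- `δ³ ≤ 5 δ^{13/3}`
  have hpow3 : (δ : ℝ) ^ 3 ≤ 5 * (δ : ℝ) ^ ((13 : ℝ) / 3) := by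
    rw [← Real.rpow_natCast]
    simp only [Nat.cast_ofNat]
    have h2 : (δ : ℝ) ^ (3 : ℝ) ≤ (δ : ℝ) ^ ((13 : ℝ) / 3) :=
      Real.rpow_le_rpow_of_exponent_le hδr1 (by norm_num)
    have h3 : 0 ≤ (δ : ℝ) ^ ((13 : ℝ) / 3) := Real.rpow_nonneg (by linarith) _
    linarith
  have hcast12 : ((((δ - 1) * (δ - 2) : ℕ)) : ℝ) = ((δ : ℝ) - 1) * ((δ : ℝ) - 2) := by
    rw [Nat.cast_mul, Nat.cast_sub (by omega), Nat.cast_sub (by omega)]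
    norm_num
  -- `q ≥ 2δ + 1` from `q > 5 δ^{10/3} ≥ 5δ`
  have hq2δ : 2 * δ + 1 ≤ Fintype.card K := by
    have h1 : (δ : ℝ) ≤ (δ : ℝ) ^ ((10 : ℝ) / 3) := by
      have := Real.rpow_le_rpow_of_exponent_le hδr1 (show (1 : ℝ) ≤ 10 / 3 by norm_num)
      rwa [Real.rpow_one] at this
    have h2 : (2 : ℝ) * δ + 1 < q := by linarith
    have h3 : ((2 * δ + 1 : ℕ) : ℝ) < (Fintype.card K : ℝ) := by rw [← hq]; push_cast; linarith
    exact (Nat.cast_lt.1 h3).le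
  rcases n with _ | _ | _ | m
  · exact absurd hf (not_isAbsIrreducible_fin_zero f)
  · exact absurd (totalDegree_eq_one_of_isAbsIrreducible_fin_one hf) hδ1
  · -- `n = 2`
    have h := abs_rationalPointCount_sub_le_fin_two hf hδ2
    rw [← hq, ← hδ, hcast12] at h
    have e1 : q ^ (((0 + 1 + 1 : ℕ) : ℝ) - 1) = q := by norm_num
    have e2 : q ^ (((0 + 1 + 1 : ℕ) : ℝ) - 3 / 2) = √q := by
      rw [Real.sqrt_eq_rpow]; norm_num
    have e3 : q ^ (((0 + 1 + 1 : ℕ) : ℝ) - 2) = 1 := by norm_num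
    rw [e1, e2, e3, mul_one]
    linarith
  · -- `n = m + 3`
    have hB := hbad K (m + 1 + 1 + 1) f hf hδ2 (by omega) hP
    rw [← hδ] at hB
    have h := abs_rationalPointCount_sub_le_of_bad_le hf hδ.symm hδ2 hq2δ (cB δ) hB
    rw [← hq, hcast12] at h
    have e1 : q ^ (((m + 1 + 1 + 1 : ℕ) : ℝ) - 1) = q ^ (m + 2) := by
      rw [← Real.rpow_natCast]; congr 1; push_cast; ring
    have e2 : q ^ (((m + 1 + 1 + 1 : ℕ) : ℝ) - 3 / 2) = q ^ (m + 1) * √q := by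
      rw [Real.sqrt_eq_rpow, ← Real.rpow_natCast, ← Real.rpow_add hq0]
      congr 1; push_cast; ring
    have e3 : q ^ (((m + 1 + 1 + 1 : ℕ) : ℝ) - 2) = q ^ (m + 1) := by
      rw [← Real.rpow_natCast]; congr 1; push_cast; ring
    rw [e1, e2, e3]
    have hnum' := hnum δ hδ2 hP
    have hqm : 0 ≤ q ^ (m + 1) := by positivity
    have key : q ^ (m + 1) * (((δ : ℝ) - 1) * ((δ : ℝ) - 2) * √q + (δ : ℝ) ^ 3 + δ ^ 2 + 1 + cB δ) ≤
        ((δ : ℝ) - 1) * ((δ : ℝ) - 2) * (q ^ (m + 1) * √q) +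
          5 * (δ : ℝ) ^ ((13 : ℝ) / 3) * q ^ (m + 1) := by
      have := mul_le_mul_of_nonneg_left hnum' hqm
      nlinarith
    exact h.trans key

/-- **Cafure–Matera (2006), Theorem 5.2, from the parametrised Proposition 4.1.** The named fact
`CafureMatera2006_thm52` (for every finite field `𝔽_q`, every `n` and every absolutely
irreducible `f ∈ 𝔽_q[X₁, …, Xₙ]` of degree `δ`,
`|#{f = 0} - q^{n-1}| ≤ (δ-1)(δ-2) q^{n-3/2} + 5δ^{13/3} q^{n-2}`) follows from the following
parametrised form of Cafure–Matera's Prop. 4.1 (the weighted count `∑_{j ≥ 1} j #Π_j` of planes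
whose section has `j + 1` — here: `j + 1` distinct `𝔽_q`-irreducible — factors; printed proof:
the effective Bertini theorems Cor. 3.2 and Cor. 3.4): for `n ≥ 3` and `f` absolutely irreducible
of degree `δ ≥ 2`, the sum over the parameters `(p, v, w) ∈ (𝔽_qⁿ)³` with `v, w` linearly
independent and `f(p + Xv + Yw)` non-zero and not irreducible over `𝔽̄_q`, of
`max(1, m - 1)` (`m` the number of distinct normalised irreducible factors of `f(p + Xv + Yw)` in
`𝔽_q[X][Y]`), is at most `(2δ^{13/3} + 3δ^{11/3}) q^{3n-1}`. The cases `δ = 1`, `q ≤ 5δ^{10/3}`,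
`n ≤ 2` do not need the hypothesis. [cite: CafureMatera2006, Prop. 4.1 and Thm. 5.2] -/
theorem CafureMatera2006_thm52_of_prop41
    (h41 : ∀ (K : Type) [Field K] [Fintype K] (n : ℕ) (f : MvPolynomial (Fin n) K),
      IsAbsIrreducible f → 2 ≤ f.totalDegree → 3 ≤ n →
        (∑ φ ∈ (Finset.univ.filter fun φ : (Fin n → K) × (Fin n → K) × (Fin n → K) ↦
            LinearIndependent K ![φ.2.1, φ.2.2] ∧ sec[K, f, φ.1, φ.2.1, φ.2.2] ≠ 0 ∧
              ¬ Irreducible ((sec[K, f, φ.1, φ.2.1, φ.2.2]).map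
                (Polynomial.mapRingHom (algebraMap K (AlgebraicClosure K))))),
          ((max 1 ((UniqueFactorizationMonoid.normalizedFactors
            (sec[K, f, φ.1, φ.2.1, φ.2.2])).toFinset.card - 1) : ℕ) : ℝ)) ≤
          (2 * (f.totalDegree : ℝ) ^ ((13 : ℝ) / 3) + 3 * (f.totalDegree : ℝ) ^ ((11 : ℝ) / 3)) *
            (Fintype.card K : ℝ) ^ (3 * n - 1)) :
    CafureMatera2006_thm52 := by
  intro K _ _ _ n f hf
  refine CafureMatera2006_thm52_of_bad_le (fun _ ↦ True)
    (fun δ ↦ 2 * (δ : ℝ) ^ ((13 : ℝ) / 3) + 3 * (δ : ℝ) ^ ((11 : ℝ) / 3))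
    (fun K _ _ n f hf hδ hn _ ↦ h41 K n f hf hδ hn) (fun δ hδ _ ↦ ?_) K n f hf trivial
  have hδr : (2 : ℝ) ≤ δ := by exact_mod_cast hδ
  have := numeric_thm52 hδr
  linarith

end Literature.NumberTheory.DiophantineGeometry

/-! ## Part 3: Theorem 5.2 for `δ ≤ 5`, unconditionally -/

open scoped Classical Polynomial.Bivariate

namespace Literature.NumberTheory.DiophantineGeometry

universe u

/-- The plane section `f(p + Xv + Yw) ∈ K[X][Y]` (local notation, as in
`CafureMateraAveragingProofs`). -/
local notation3 (prettyPrint := false) "sec[" K ", " f ", " p ", " v ", " w "]" =>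
  (MvPolynomial.aeval (R := K) (fun i ↦ Polynomial.C (Polynomial.C (w i)) * Polynomial.X +
      Polynomial.C (Polynomial.C (p i) + Polynomial.C (v i) * Polynomial.X)) f)

section Weights

variable {K : Type u} [Field K] {n : ℕ}

/-- **The weights are at most `δ - 1`:** a non-zero section `f(p + Xv + Yw)` of a polynomial of
degree `δ ≥ 2` has at most `δ` distinct irreducible factors, so `max(1, m - 1) ≤ δ - 1`.
[folklore] -/
theorem max_one_card_normalizedFactors_sub_one_le {f : MvPolynomial (Fin n) K} {δ : ℕ}
    (hδ : f.totalDegree = δ) (hδ2 : 2 ≤ δ) (p v w : Fin n → K) (h0 : sec[K, f, p, v, w] ≠ 0) :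
    max 1 ((UniqueFactorizationMonoid.normalizedFactors (sec[K, f, p, v, w])).toFinset.card - 1) ≤
      δ - 1 := by
  have hsup := PlaneShear.card_normalizedFactors_toFinset_le_sup_support h0
  have hTD := coeff_coeff_planeSection_eq_zero f p v w
  rw [hδ] at hTD
  have hle : ((sec[K, f, p, v, w]).support.sup fun k ↦
      ((sec[K, f, p, v, w]).coeff k).natDegree + k) ≤ δ :=
    Finset.sup_le fun k hk ↦ PlaneShear.natDegree_coeff_add_le_of_coeff_coeff_eq_zero hTD k
      (Polynomial.mem_support_iff.1 hk)
  have := hsup.trans hle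
  omega

variable [Fintype K]

/-- **The weighted number of bad planes in terms of the parametrised Cor. 3.2:**
`∑_{φ bad} max(1, m(f_φ) - 1) ≤ (δ - 1) · #{φ : f_φ not absolutely irreducible}
 ≤ (δ - 1) ((δ+1) + (2δ-1)δ + δ²(2δ²-δ)) q^{n-1} q^{2n}`.
[cite: CafureMatera2006, Cor. 3.2 and Prop. 4.1] -/
theorem sum_bad_weight_le {f : MvPolynomial (Fin n) K} (hf : IsAbsIrreducible f) {δ : ℕ}
    (hδ : f.totalDegree = δ) (hδ2 : 2 ≤ δ) :
    (∑ φ ∈ (Finset.univ.filter fun φ : (Fin n → K) × (Fin n → K) × (Fin n → K) ↦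
        LinearIndependent K ![φ.2.1, φ.2.2] ∧ sec[K, f, φ.1, φ.2.1, φ.2.2] ≠ 0 ∧
          ¬ Irreducible ((sec[K, f, φ.1, φ.2.1, φ.2.2]).map
            (Polynomial.mapRingHom (algebraMap K (AlgebraicClosure K))))),
      ((max 1 ((UniqueFactorizationMonoid.normalizedFactors
        (sec[K, f, φ.1, φ.2.1, φ.2.2])).toFinset.card - 1) : ℕ) : ℝ)) ≤
      ((δ - 1 : ℕ) : ℝ) *
        ((((δ + 1) + (δ + (δ - 1)) * δ + δ ^ 2 * (2 * δ ^ 2 - δ)) *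
          Fintype.card K ^ (n - 1) * (Fintype.card K ^ n * Fintype.card K ^ n) : ℕ) : ℝ) := by
  set Bad := Finset.univ.filter fun φ : (Fin n → K) × (Fin n → K) × (Fin n → K) ↦
    LinearIndependent K ![φ.2.1, φ.2.2] ∧ sec[K, f, φ.1, φ.2.1, φ.2.2] ≠ 0 ∧
      ¬ Irreducible ((sec[K, f, φ.1, φ.2.1, φ.2.2]).map
        (Polynomial.mapRingHom (algebraMap K (AlgebraicClosure K)))) with hBad
  have hcount := card_filter_not_irreducible_planeSection_le hf
  rw [hδ] at hcount
  have hsub : Bad.card ≤ ((δ + 1) + (δ + (δ - 1)) * δ + δ ^ 2 * (2 * δ ^ 2 - δ)) *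
      Fintype.card K ^ (n - 1) * (Fintype.card K ^ n * Fintype.card K ^ n) := by
    refine le_trans (Finset.card_le_card fun φ hφ ↦ ?_) hcount
    rw [hBad, Finset.mem_filter] at hφ
    rw [Finset.mem_filter]
    exact ⟨hφ.1, hφ.2.2.2⟩
  have hterm : ∀ φ ∈ Bad, ((max 1 ((UniqueFactorizationMonoid.normalizedFactors
      (sec[K, f, φ.1, φ.2.1, φ.2.2])).toFinset.card - 1) : ℕ) : ℝ) ≤ ((δ - 1 : ℕ) : ℝ) := by
    intro φ hφ
    rw [hBad, Finset.mem_filter] at hφ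
    exact_mod_cast max_one_card_normalizedFactors_sub_one_le hδ hδ2 φ.1 φ.2.1 φ.2.2 hφ.2.2.1
  calc _ ≤ ∑ _φ ∈ Bad, ((δ - 1 : ℕ) : ℝ) := Finset.sum_le_sum hterm
    _ = Bad.card * ((δ - 1 : ℕ) : ℝ) := by rw [Finset.sum_const, nsmul_eq_mul]
    _ ≤ _ := by
        rw [mul_comm]
        exact mul_le_mul_of_nonneg_left (by exact_mod_cast hsub) (Nat.cast_nonneg _)

end Weights

/-! ### Lower bounds for `δ^{13/3}` by cubing -/

/-- `c ≤ d^{13/3}` as soon as `c³ ≤ d¹³` (`d ≥ 0`). [folklore] -/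
theorem le_rpow_thirteen_thirds {d c : ℝ} (hd : 0 ≤ d) (h : c ^ 3 ≤ d ^ 13) :
    c ≤ d ^ ((13 : ℝ) / 3) := by
  have hx0 : 0 ≤ d ^ ((13 : ℝ) / 3) := Real.rpow_nonneg hd _
  have hx3 : (d ^ ((13 : ℝ) / 3)) ^ 3 = d ^ 13 := by
    rw [← Real.rpow_natCast, ← Real.rpow_mul hd]
    norm_num
  by_contra hlt
  rw [not_le] at hlt
  have : (d ^ ((13 : ℝ) / 3)) ^ 3 < c ^ 3 := pow_lt_pow_left₀ hlt hx0 (by norm_num)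
  rw [hx3] at this
  linarith

/-! ### Theorem 5.2 for `δ ≤ 5` -/

/-- **Cafure–Matera (2006), Theorem 5.2, for absolutely irreducible hypersurfaces of degree
`δ ≤ 5` (unconditional).** For `K = 𝔽_q`, `f ∈ K[X₁, …, Xₙ]` absolutely irreducible of total
degree `δ ≤ 5` and `N = #{x ∈ Kⁿ : f(x) = 0}`:
`|N - q^{n-1}| ≤ (δ-1)(δ-2) q^{n-3/2} + 5 δ^{13/3} q^{n-2}`. Proof: `CafureMatera2006_thm52_of_bad_le`
with the weighted bad-plane count bounded through the parametrised Cor. 3.2 alone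
(`sum_bad_weight_le`, constant `(δ-1)(2δ⁴ - δ³ + 2δ² + 1)`), which fits under `5δ^{13/3}` together
with the lower-order terms `δ³ + δ² + 1` exactly for `δ ≤ 5` (`46 ≤ 100`, `345 ≤ 580`,
`1524 ≤ 2030`, `4855 ≤ 5340`). [cite: CafureMatera2006, Thm. 5.2] [cite: Kaltofen1995, Thm. 5] -/
theorem CafureMatera2006_thm52_of_totalDegree_le_five (K : Type) [Field K] [Fintype K]
    [DecidableEq K] (n : ℕ) (f : MvPolynomial (Fin n) K) (hf : IsAbsIrreducible f)
    (h5 : f.totalDegree ≤ 5) :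
    |(rationalPointCount f : ℝ) - (Fintype.card K : ℝ) ^ ((n : ℝ) - 1)| ≤
      ((f.totalDegree : ℝ) - 1) * ((f.totalDegree : ℝ) - 2) *
          (Fintype.card K : ℝ) ^ ((n : ℝ) - 3 / 2) +
        5 * (f.totalDegree : ℝ) ^ ((13 : ℝ) / 3) * (Fintype.card K : ℝ) ^ ((n : ℝ) - 2) := by
  refine CafureMatera2006_thm52_of_bad_le (fun δ ↦ δ ≤ 5)
    (fun δ ↦ ((δ - 1 : ℕ) : ℝ) *
      ((((δ + 1) + (δ + (δ - 1)) * δ + δ ^ 2 * (2 * δ ^ 2 - δ)) : ℕ) : ℝ))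
    (fun K _ _ n f hf hδ2 hn _ ↦ ?_) (fun δ hδ2 hδ5 ↦ ?_) K n f hf h5
  · -- the bad-plane bound, with `q^{n-1} q^n q^n = q^{3n-1}`
    have h := sum_bad_weight_le hf rfl hδ2
    refine h.trans (le_of_eq ?_)
    obtain ⟨m, rfl⟩ : ∃ m, n = m + 1 := ⟨n - 1, by omega⟩
    rw [show 3 * (m + 1) - 1 = 3 * m + 2 by omega, show m + 1 - 1 = m by omega]
    push_cast
    ring
  · -- the numerics for `δ = 2, 3, 4, 5`
    have hδ0 : (0 : ℝ) ≤ δ := Nat.cast_nonneg _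
    interval_cases δ
    · have hx : (20 : ℝ) ≤ (2 : ℝ) ^ ((13 : ℝ) / 3) :=
        le_rpow_thirteen_thirds (by norm_num) (by norm_num)
      norm_num at hx ⊢
      linarith
    · have hx : (116 : ℝ) ≤ (3 : ℝ) ^ ((13 : ℝ) / 3) :=
        le_rpow_thirteen_thirds (by norm_num) (by norm_num)
      norm_num at hx ⊢
      linarith
    · have hx : (406 : ℝ) ≤ (4 : ℝ) ^ ((13 : ℝ) / 3) :=
        le_rpow_thirteen_thirds (by norm_num) (by norm_num)
      norm_num at hx ⊢
      linarith
    · have hx : (1068 : ℝ) ≤ (5 : ℝ) ^ ((13 : ℝ) / 3) :=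
        le_rpow_thirteen_thirds (by norm_num) (by norm_num)
      norm_num at hx ⊢
      linarith

end Literature.NumberTheory.DiophantineGeometry
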